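import Mathlib.RingTheory.Ideal.GoingUp
import Mathlib.RingTheory.Jacobson.Ring
import Mathlib.RingTheory.Ideal.MinimalPrime.Noetherian
import Mathlib.RingTheory.Localization.FractionRing
import Mathlib.RingTheory.Polynomial.Quotient
import Mathlib.FieldTheory.IsAlgClosed.Basic
import Mathlib.Algebra.Field.Subfield.Basic
import Literature.AlgebraicGeometry.Motives.CurveThroughTwoPointsHypersurfaceModel
import HarnessLib

/-!
# Commutative-algebra lemmas for the elementary proof of Mumford's two-point lemma

Topic `Literature/AlgebraicGeometry/Motives`; auxiliary results for the proof of the two-point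
curve lemma (`Motives/CurveThroughTwoPoints`, `mumford_smoothCurve_through_two_points`; Mumford,
*Abelian Varieties*, §6, Lemma), all folklore:

* `exists_isMaximal_notMem_of_ne_zero` — in a Jacobson domain which is not a field, a nonzero
  element lies outside some nonzero maximal ideal;
* `exists_denominator_of_mem_closure` — elements of the subfield generated by a subring have
  denominators in the subring; `exists_common_denominator` — finitely many at once;
* `isPrime_map_range_of_isPrime_fibre`, `exists_remainder_witness` — the fibre `𝔞B₀` of a
  hypersurface model `B₀ = R[v] ≅ R[X]/(F)` over a maximal ideal `𝔞 ⊆ R` is prime as soon as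
  `F mod 𝔞` generates a prime ideal, and an element of `B₀` whose reduced representative has a
  coefficient outside `𝔞` does not lie in `𝔞B₀`;
* `exists_avoid_minimalPrimes` — finitely many minimal primes contract to ideals avoided by every
  ideal missing one nonzero element;
* `exists_prime_over_section` — if `σ : B → P` is a retraction of `P ⊆ B`, `B'` is integral over
  `B` and `R ⊆ B'` is integral over `P` with `R ∩ 𝔯'' = 0` for a prime `𝔯''` of `B'` over `ker σ`,
  then every maximal ideal of `R` lies under a prime of `B'` containing `𝔯''` (lying over in
  `B'/𝔯''`, which is integral over `R` because `B = P + ker σ`);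
* `exists_algHom_ker_eq_of_isMaximal` — closed points of a variety over an algebraically closed
  field are rational (Zariski's lemma);
* `transcendental_div_of_notMem_minimalPrimes` — a pencil parameter `g/h` with `h` outside the
  minimal primes of `(g)` is transcendental over the constants;
* `isFractionRing_of_subalgebra` — an intermediate ring `A ⊆ B ⊆ Frac A` has the same fraction
  field.

Everything is proved; no named facts.

## References

* D. Mumford, *Abelian Varieties* (1970), §6, Lemma. [MumfordAV1970]
-/

noncomputable section

open Polynomial

namespace Literature.AlgebraicGeometry.Motives

namespace TwoPointPencil

universe u

/-! ### Maximal ideals avoiding an element -/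

/-- In a Jacobson domain which is not a field, every nonzero element lies outside some nonzero
maximal ideal (the Jacobson radical is the nilradical, which is zero). [folklore] -/
theorem exists_isMaximal_notMem_of_ne_zero {R : Type*} [CommRing R] [IsDomain R]
    [IsJacobsonRing R] (hR : ¬ IsField R) {ε : R} (hε : ε ≠ 0) :
    ∃ 𝔞 : Ideal R, 𝔞.IsMaximal ∧ 𝔞 ≠ ⊥ ∧ ε ∉ 𝔞 := by
  have hjac : (⊥ : Ideal R).jacobson = ⊥ := IsJacobsonRing.out ‹_› Ideal.isRadical_bot
  have hε' : ε ∉ (⊥ : Ideal R).jacobson := by rwa [hjac, Ideal.mem_bot]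
  rw [Ideal.jacobson, Ideal.mem_sInf] at hε'
  push Not at hε'
  obtain ⟨𝔞, ⟨-, h𝔞⟩, hε𝔞⟩ := hε'
  refine ⟨𝔞, h𝔞, fun h => hR ?_, hε𝔞⟩
  rw [Ring.isField_iff_maximal_bot, ← h]
  exact h𝔞

/-! ### Denominators -/

/-- Elements of the subfield generated by a set contained in a subring `S` of a field have a
nonzero denominator in `S`. [folklore] -/
theorem exists_denominator_of_mem_closure {E : Type*} [Field E] (S : Subring E) {G : Set E}
    (hG : G ⊆ S) {z : E} (hz : z ∈ Subfield.closure G) :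
    ∃ d ∈ S, d ≠ 0 ∧ d * z ∈ S := by
  induction hz using Subfield.closure_induction with
  | mem x hx => exact ⟨1, S.one_mem, one_ne_zero, by simpa using hG hx⟩
  | one => exact ⟨1, S.one_mem, one_ne_zero, by simp⟩
  | add x y _ _ hx hy =>
    obtain ⟨d₁, hd₁, hd₁0, h₁⟩ := hx
    obtain ⟨d₂, hd₂, hd₂0, h₂⟩ := hy
    refine ⟨d₁ * d₂, S.mul_mem hd₁ hd₂, mul_ne_zero hd₁0 hd₂0, ?_⟩
    have : d₁ * d₂ * (x + y) = d₂ * (d₁ * x) + d₁ * (d₂ * y) := by ring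
    rw [this]
    exact S.add_mem (S.mul_mem hd₂ h₁) (S.mul_mem hd₁ h₂)
  | neg x _ hx =>
    obtain ⟨d, hd, hd0, h⟩ := hx
    exact ⟨d, hd, hd0, by rw [mul_neg]; exact S.neg_mem h⟩
  | inv x _ hx =>
    obtain ⟨d, hd, hd0, h⟩ := hx
    rcases eq_or_ne x 0 with rfl | hx0
    · exact ⟨1, S.one_mem, one_ne_zero, by simp⟩
    · refine ⟨d * x, h, mul_ne_zero hd0 hx0, ?_⟩
      rw [mul_assoc, mul_inv_cancel₀ hx0, mul_one]
      exact hd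
  | mul x y _ _ hx hy =>
    obtain ⟨d₁, hd₁, hd₁0, h₁⟩ := hx
    obtain ⟨d₂, hd₂, hd₂0, h₂⟩ := hy
    refine ⟨d₁ * d₂, S.mul_mem hd₁ hd₂, mul_ne_zero hd₁0 hd₂0, ?_⟩
    have : d₁ * d₂ * (x * y) = (d₁ * x) * (d₂ * y) := by ring
    rw [this]
    exact S.mul_mem h₁ h₂

/-- A common denominator for finitely many elements. [folklore] -/
theorem exists_common_denominator {E : Type*} [Field E] (S : Subring E) (s : Finset E)
    (hs : ∀ g ∈ s, ∃ d ∈ S, d ≠ 0 ∧ d * g ∈ S) :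
    ∃ c ∈ S, c ≠ 0 ∧ ∀ g ∈ s, c * g ∈ S := by
  classical
  induction s using Finset.induction_on with
  | empty => exact ⟨1, S.one_mem, one_ne_zero, by simp⟩
  | insert a s ha ih =>
    obtain ⟨c, hc, hc0, hcs⟩ := ih fun g hg => hs g (Finset.mem_insert_of_mem hg)
    obtain ⟨d, hd, hd0, hda⟩ := hs a (Finset.mem_insert_self a s)
    refine ⟨c * d, S.mul_mem hc hd, mul_ne_zero hc0 hd0, fun g hg => ?_⟩
    rcases Finset.mem_insert.mp hg with rfl | hg
    · rw [mul_assoc]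
      exact S.mul_mem hc hda
    · rw [mul_comm c d, mul_assoc]
      exact S.mul_mem hd (hcs g hg)

/-! ### The fibre of a hypersurface model over a maximal ideal -/

section Fibre

variable {R : Type*} [CommRing R] {σ : Type*}

/-- For a surjection `π : R → k` with kernel `𝔞`, the preimage of `(F^π) ⊆ k[X]` in `R[X]` is
`𝔞R[X] + (F)`. [folklore] -/
theorem comap_map_span_eq (𝔞 : Ideal R) (F : MvPolynomial σ R) :
    (Ideal.span {MvPolynomial.map (Ideal.Quotient.mk 𝔞) F}).comap
        (MvPolynomial.map (Ideal.Quotient.mk 𝔞)) =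
      𝔞.map (MvPolynomial.C : R →+* MvPolynomial σ R) ⊔ Ideal.span {F} := by
  set π := Ideal.Quotient.mk 𝔞 with hπ
  have hker : RingHom.ker (MvPolynomial.map (σ := σ) π) = 𝔞.map MvPolynomial.C := by
    rw [MvPolynomial.ker_map, Ideal.mk_ker]
  apply le_antisymm
  · intro p hp
    rw [Ideal.mem_comap, Ideal.mem_span_singleton] at hp
    obtain ⟨q, hq⟩ := hp
    obtain ⟨q', rfl⟩ := MvPolynomial.map_surjective π Ideal.Quotient.mk_surjective q
    have hmem : p - F * q' ∈ RingHom.ker (MvPolynomial.map (σ := σ) π) := by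
      rw [RingHom.mem_ker, map_sub, map_mul, hq, sub_self]
    rw [hker] at hmem
    have : p = (p - F * q') + F * q' := by ring
    rw [this]
    exact Ideal.add_mem _ (Ideal.mem_sup_left hmem)
      (Ideal.mem_sup_right (Ideal.mul_mem_right _ _ (Ideal.mem_span_singleton_self F)))
  · refine sup_le ?_ ?_
    · rw [← hker]
      intro p hp
      rw [Ideal.mem_comap, RingHom.mem_ker.mp hp]
      exact zero_mem _
    · rw [Ideal.span_singleton_le_iff_mem, Ideal.mem_comap]
      exact Ideal.mem_span_singleton_self _

variable {E : Type*} [CommRing E] [Algebra R E] {n : ℕ}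

/-- **The fibre of a hypersurface model.** Let `B₀ = R[v] ⊆ E` be the image of `R[X₁, …, X_n]`
under evaluation at `v`, with kernel `(F)`, and let `𝔞 ⊆ R` be an ideal such that `(F mod 𝔞)` is a
prime ideal of `(R/𝔞)[X]`. Then `𝔞B₀` is prime, and an element `p(v) ∈ 𝔞B₀` has
`p mod 𝔞 ∈ (F mod 𝔞)`. [folklore] -/
theorem isPrime_map_range_of_isPrime_fibre (v : Fin n → E) (F : MvPolynomial (Fin n) R)
    (hker : RingHom.ker (MvPolynomial.aeval v : MvPolynomial (Fin n) R →ₐ[R] E) = Ideal.span {F})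
    (𝔞 : Ideal R)
    (hF : (Ideal.span {MvPolynomial.map (Ideal.Quotient.mk 𝔞) F}).IsPrime) :
    (𝔞.map (algebraMap R (MvPolynomial.aeval v : MvPolynomial (Fin n) R →ₐ[R] E).range)).IsPrime ∧
      ∀ p : MvPolynomial (Fin n) R,
        (MvPolynomial.aeval v : MvPolynomial (Fin n) R →ₐ[R] E).rangeRestrict p ∈
            𝔞.map (algebraMap R (MvPolynomial.aeval v : MvPolynomial (Fin n) R →ₐ[R] E).range) →
          MvPolynomial.map (Ideal.Quotient.mk 𝔞) p ∈
            Ideal.span {MvPolynomial.map (Ideal.Quotient.mk 𝔞) F} := by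
  set θ : MvPolynomial (Fin n) R →ₐ[R] (MvPolynomial.aeval v : MvPolynomial (Fin n) R →ₐ[R] E).range :=
    (MvPolynomial.aeval v).rangeRestrict with hθ
  have hθs : Function.Surjective θ := AlgHom.rangeRestrict_surjective _
  have hθker : RingHom.ker θ = Ideal.span {F} := by
    rw [← hker, hθ]
    exact AlgHom.ker_rangeRestrict _
  set J : Ideal (MvPolynomial (Fin n) R) :=
    (Ideal.span {MvPolynomial.map (Ideal.Quotient.mk 𝔞) F}).comap
      (MvPolynomial.map (Ideal.Quotient.mk 𝔞)) with hJ
  have hJprime : J.IsPrime := Ideal.comap_isPrime _ _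
  have hJeq : J = 𝔞.map (MvPolynomial.C : R →+* MvPolynomial (Fin n) R) ⊔ Ideal.span {F} :=
    comap_map_span_eq 𝔞 F
  have hkerJ : RingHom.ker θ ≤ J := by
    rw [hθker, hJeq]
    exact le_sup_right
  -- `J.map θ = 𝔞B₀`
  have hmapJ : J.map θ = 𝔞.map (algebraMap R (MvPolynomial.aeval v).range) := by
    rw [hJeq, Ideal.map_sup, Ideal.map_span, Set.image_singleton]
    have h0 : θ F = 0 := by
      rw [← RingHom.mem_ker, hθker]
      exact Ideal.mem_span_singleton_self F
    rw [h0, Ideal.span_singleton_zero, sup_bot_eq]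
    change Ideal.map θ.toRingHom (Ideal.map MvPolynomial.C 𝔞) = _
    rw [Ideal.map_map]
    congr 1
    exact RingHom.ext fun r => θ.commutes r
  refine ⟨hmapJ ▸ Ideal.map_isPrime_of_surjective hθs hkerJ, fun p hp => ?_⟩
  have : p ∈ J := by
    have h := Ideal.mem_comap.mpr (hmapJ ▸ hp : θ p ∈ J.map θ)
    rwa [Ideal.comap_map_of_surjective _ hθs, ← RingHom.ker_eq_comap_bot,
      sup_eq_left.mpr hkerJ] at h
  exact Ideal.mem_comap.mp this

variable [IsDomain R] {m : ℕ}

/-- **Reduced representatives.** If `F ∈ R[X₀, …, X_m]` is monic in `X₀` and `c̃ ∉ (F)`, then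
`c̃ ≡ r̃ (mod F)` for a remainder `r̃` of `X₀`-degree `< deg F` which has a nonzero coefficient
`γ`; and whenever `r̃ mod 𝔞 ∈ (F mod 𝔞)` for a prime `𝔞`, all coefficients of `r̃`, in particular
`γ`, lie in `𝔞` (division by the monic `F mod 𝔞` is unique). [folklore] -/
theorem exists_remainder_witness (F : MvPolynomial (Fin (m + 1)) R)
    (hFm : (MvPolynomial.finSuccEquiv R m F).Monic) (c : MvPolynomial (Fin (m + 1)) R)
    (hc : c ∉ Ideal.span {F}) :
    ∃ (r : MvPolynomial (Fin (m + 1)) R) (γ : R), γ ≠ 0 ∧ c - r ∈ Ideal.span {F} ∧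
      ∀ 𝔞 : Ideal R, 𝔞.IsPrime →
        MvPolynomial.map (Ideal.Quotient.mk 𝔞) r ∈
          Ideal.span {MvPolynomial.map (Ideal.Quotient.mk 𝔞) F} → γ ∈ 𝔞 := by
  -- an opaque name for the distinguished-variable isomorphism
  obtain ⟨e, he⟩ : ∃ e : MvPolynomial (Fin (m + 1)) R ≃ₐ[R] Polynomial (MvPolynomial (Fin m) R),
      e = MvPolynomial.finSuccEquiv R m := ⟨_, rfl⟩
  have hFm' : (e F).Monic := by rw [he]; exact hFm
  obtain ⟨r, hr⟩ : ∃ r : MvPolynomial (Fin (m + 1)) R, r = e.symm (e c %ₘ e F) := ⟨_, rfl⟩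
  have her : e r = e c %ₘ e F := by rw [hr, e.apply_symm_apply]
  have hcr : c - r ∈ Ideal.span {F} := by
    rw [Ideal.mem_span_singleton]
    refine ⟨e.symm (e c /ₘ e F), e.injective ?_⟩
    rw [map_sub, map_mul, her, e.apply_symm_apply]
    have := Polynomial.modByMonic_add_div (e c) (e F)
    linear_combination -this
  have hr0 : r ≠ 0 := by
    intro h
    apply hc
    rw [h, sub_zero] at hcr
    exact hcr
  obtain ⟨d, hd⟩ := MvPolynomial.ne_zero_iff.mp hr0
  refine ⟨r, r.coeff d, hd, hcr, fun 𝔞 h𝔞 hmem => ?_⟩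
  -- `r mod 𝔞` is divisible by the monic `F mod 𝔞` and has smaller `X₀`-degree, so vanishes
  have hmap : ∀ p : MvPolynomial (Fin (m + 1)) R,
      MvPolynomial.finSuccEquiv (R ⧸ 𝔞) m (MvPolynomial.map (Ideal.Quotient.mk 𝔞) p) =
        Polynomial.map (MvPolynomial.map (Ideal.Quotient.mk 𝔞)) (e p) := by
    intro p
    rw [he]
    exact finSuccEquiv_map _ _ _
  have hzero : MvPolynomial.map (Ideal.Quotient.mk 𝔞) r = 0 := by
    rw [Ideal.mem_span_singleton] at hmem
    have hdvd := map_dvd (MvPolynomial.finSuccEquiv (R ⧸ 𝔞) m) hmem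
    rw [hmap, hmap, her] at hdvd
    have hmon : (Polynomial.map (MvPolynomial.map (Ideal.Quotient.mk 𝔞)) (e F)).Monic :=
      hFm'.map _
    by_contra hne
    have hne' : Polynomial.map (MvPolynomial.map (Ideal.Quotient.mk 𝔞)) (e c %ₘ e F) ≠ 0 := by
      intro h0
      apply hne
      apply (MvPolynomial.finSuccEquiv (R ⧸ 𝔞) m).injective
      rw [hmap, map_zero, her, h0]
    haveI : Nontrivial (R ⧸ 𝔞) := Submodule.Quotient.nontrivial_iff.mpr h𝔞.ne_top
    refine hmon.not_dvd_of_degree_lt hne' ?_ hdvd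
    calc (Polynomial.map (MvPolynomial.map (Ideal.Quotient.mk 𝔞)) (e c %ₘ e F)).degree
        ≤ (e c %ₘ e F).degree := Polynomial.degree_map_le
      _ < (e F).degree := Polynomial.degree_modByMonic_lt _ hFm'
      _ = (Polynomial.map (MvPolynomial.map (Ideal.Quotient.mk 𝔞)) (e F)).degree :=
          (hFm'.degree_map _).symm
  have := congrArg (MvPolynomial.coeff d) hzero
  rw [MvPolynomial.coeff_map, MvPolynomial.coeff_zero, Ideal.Quotient.eq_zero_iff_mem] at this
  exact this

end Fibre

/-! ### Avoiding the contractions of finitely many minimal primes -/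

/-- For a noetherian `S`, a map `ψ : R → S` from a domain and an ideal `I ⊆ S` there is
`ε ≠ 0` in `R` such that no minimal prime of `I` contracts to a nonzero ideal missing `ε`.
[folklore] -/
theorem exists_avoid_minimalPrimes {R S : Type*} [CommRing R] [IsDomain R] [CommRing S]
    [IsNoetherianRing S] (ψ : R →+* S) (I : Ideal S) :
    ∃ ε : R, ε ≠ 0 ∧ ∀ 𝔞 : Ideal R, 𝔞 ≠ ⊥ → ε ∉ 𝔞 →
      ∀ 𝔠 ∈ I.minimalPrimes, 𝔠.comap ψ ≠ 𝔞 := by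
  classical
  have hfin : I.minimalPrimes.Finite := Ideal.finite_minimalPrimes_of_isNoetherianRing S I
  -- a nonzero element of each nonzero contraction
  let w : Ideal S → R := fun 𝔠 =>
    if h : 𝔠.comap ψ = ⊥ then 1 else Classical.choose (Submodule.exists_mem_ne_zero_of_ne_bot h)
  have hw0 : ∀ 𝔠, w 𝔠 ≠ 0 := by
    intro 𝔠
    by_cases h : 𝔠.comap ψ = ⊥
    · simp [w, h]
    · simp only [w, h, dite_false]
      exact (Classical.choose_spec (Submodule.exists_mem_ne_zero_of_ne_bot h)).2
  have hwmem : ∀ 𝔠, 𝔠.comap ψ ≠ ⊥ → w 𝔠 ∈ 𝔠.comap ψ := by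
    intro 𝔠 h
    simp only [w, h, dite_false]
    exact (Classical.choose_spec (Submodule.exists_mem_ne_zero_of_ne_bot h)).1
  refine ⟨∏ 𝔠 ∈ hfin.toFinset, w 𝔠, Finset.prod_ne_zero_iff.mpr fun 𝔠 _ => hw0 𝔠,
    fun 𝔞 h𝔞 hε 𝔠 h𝔠 heq => hε ?_⟩
  have hmem : 𝔠 ∈ hfin.toFinset := hfin.mem_toFinset.mpr h𝔠
  rw [← Finset.mul_prod_erase _ _ hmem]
  refine Ideal.mul_mem_right _ _ ?_
  rw [← heq]
  exact hwmem 𝔠 (heq ▸ h𝔞)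

/-! ### Lying over both section kernels -/

/-- **Primes over a maximal ideal of the base containing a given section curve.** Let `σ : B → P`
be a retraction of `ι : P → B` (`σ ∘ ι = id`), `B'` an integral `B`-algebra which is a domain,
`R` an integral `P`-algebra which is a domain (with `P` nontrivial), `ψ : R → B'` compatible with
`ι` (`ψ ∘ (P → R) = (B → B') ∘ ι`), and `𝔯'' ⊆ B'` a prime with `𝔯'' ∩ B = ker σ`. Then for every
maximal ideal `𝔞 ⊆ R` there is a prime `𝔔 ⊇ 𝔯''` of `B'` containing `ψ(𝔞)`: the composite
`R → B'/𝔯''` is injective (its kernel contracts to `ker (σ ∘ ι) = 0` in `P`) and integral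
(`B = ι(P) + ker σ`, so `B'/𝔯''` is integral over the image of `P`), and one lies over `𝔞`.
[folklore] -/
theorem exists_prime_over_section {P B Bt R : Type*} [CommRing P] [Nontrivial P] [CommRing B]
    [CommRing Bt] [IsDomain Bt] [CommRing R] [IsDomain R] [Algebra B Bt] [Algebra.IsIntegral B Bt]
    [Algebra P R] [Algebra.IsIntegral P R] (σ : B →+* P) (ι : P →+* B) (hσι : ∀ p, σ (ι p) = p)
    (ψ : R →+* Bt) (hψ : ∀ p, ψ (algebraMap P R p) = algebraMap B Bt (ι p)) (𝔯 : Ideal Bt)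
    [𝔯.IsPrime] (h𝔯 : 𝔯.comap (algebraMap B Bt) = RingHom.ker σ) (𝔞 : Ideal R) [𝔞.IsMaximal] :
    ∃ 𝔔 : Ideal Bt, 𝔔.IsPrime ∧ 𝔯 ≤ 𝔔 ∧ ∀ r ∈ 𝔞, ψ r ∈ 𝔔 := by
  set ρ : R →+* Bt ⧸ 𝔯 := (Ideal.Quotient.mk 𝔯).comp ψ with hρ
  letI : Algebra R (Bt ⧸ 𝔯) := ρ.toAlgebra
  have halg : ∀ r, algebraMap R (Bt ⧸ 𝔯) r = Ideal.Quotient.mk 𝔯 (ψ r) := fun _ => rfl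
  -- `B → B'/𝔯''` factors through `σ`: the two maps `B → B'/𝔯''` agree
  set τ : B →+* R := (algebraMap P R).comp σ with hτ
  have hcomp : ρ.comp τ = (Ideal.Quotient.mk 𝔯).comp (algebraMap B Bt) := by
    ext b
    change Ideal.Quotient.mk 𝔯 (ψ (algebraMap P R (σ b))) = Ideal.Quotient.mk 𝔯 (algebraMap B Bt b)
    rw [hψ, Ideal.Quotient.eq, ← map_sub, ← Ideal.mem_comap, h𝔯, RingHom.mem_ker, map_sub, hσι,
      sub_self]
  -- integrality of `B'/𝔯''` over `R`
  haveI : Algebra.IsIntegral R (Bt ⧸ 𝔯) := by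
    refine ⟨fun q => ?_⟩
    obtain ⟨z, rfl⟩ := Ideal.Quotient.mk_surjective q
    obtain ⟨f, hfm, hfz⟩ := Algebra.IsIntegral.isIntegral (R := B) z
    refine ⟨f.map τ, hfm.map τ, ?_⟩
    change Polynomial.eval₂ ρ (Ideal.Quotient.mk 𝔯 z) (f.map τ) = 0
    rw [Polynomial.eval₂_map, hcomp, ← Polynomial.hom_eval₂, hfz, map_zero]
  -- injectivity: the kernel of `ρ` contracts to `0` in `P`
  have hker : RingHom.ker (algebraMap R (Bt ⧸ 𝔯)) ≤ 𝔞 := by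
    have hk : RingHom.ker ρ = 𝔯.comap ψ := by
      rw [hρ, ← RingHom.comap_ker, Ideal.mk_ker]
    have hbot : (𝔯.comap ψ).comap (algebraMap P R) = ⊥ := by
      refine eq_bot_iff.mpr fun p hp => ?_
      rw [Ideal.mem_comap, Ideal.mem_comap, hψ, ← Ideal.mem_comap, h𝔯, RingHom.mem_ker, hσι] at hp
      rw [hp]
      exact zero_mem _
    haveI : (𝔯.comap ψ).IsPrime := Ideal.comap_isPrime _ _
    have : 𝔯.comap ψ = ⊥ := Ideal.eq_bot_of_comap_eq_bot hbot
    change RingHom.ker ρ ≤ 𝔞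
    rw [hk, this]
    exact bot_le
  obtain ⟨𝔔', h𝔔'max, h𝔔'⟩ := Ideal.exists_ideal_over_maximal_of_isIntegral 𝔞 hker
  refine ⟨𝔔'.comap (Ideal.Quotient.mk 𝔯), Ideal.comap_isPrime _ _, fun x hx => ?_, fun r hr => ?_⟩
  · rw [Ideal.mem_comap, Ideal.Quotient.eq_zero_iff_mem.mpr hx]
    exact zero_mem _
  · rw [Ideal.mem_comap, ← halg, ← Ideal.mem_comap, h𝔔']
    exact hr

/-! ### Rational closed points, transcendence of the pencil parameter, fraction fields -/

/-- **Closed points of a variety over an algebraically closed field are rational**: for a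
maximal ideal `𝔪` of a finitely generated algebra `A` over an algebraically closed field `K`
there is a `K`-algebra map `A → K` with kernel `𝔪` (Zariski's lemma: `A/𝔪` is finite over `K`,
hence equal to `K`). [folklore] -/
theorem exists_algHom_ker_eq_of_isMaximal {K : Type u} [Field K] [IsAlgClosed K] {A : Type u}
    [CommRing A] [Algebra K A] [Algebra.FiniteType K A] (𝔪 : Ideal A) [𝔪.IsMaximal] :
    ∃ ev : A →ₐ[K] K, RingHom.ker ev = 𝔪 := by
  letI : Field (A ⧸ 𝔪) := Ideal.Quotient.field 𝔪
  haveI : Module.Finite K (A ⧸ 𝔪) := finite_of_finite_type_of_isJacobsonRing K (A ⧸ 𝔪)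
  haveI : Algebra.IsIntegral K (A ⧸ 𝔪) := Algebra.IsIntegral.of_finite K (A ⧸ 𝔪)
  have hbij : Function.Bijective (algebraMap K (A ⧸ 𝔪)) :=
    IsAlgClosed.algebraMap_bijective_of_isIntegral
  let e : K ≃ₐ[K] A ⧸ 𝔪 := AlgEquiv.ofBijective (Algebra.ofId K (A ⧸ 𝔪)) hbij
  refine ⟨(e.symm : (A ⧸ 𝔪) →ₐ[K] K).comp (Ideal.Quotient.mkₐ K 𝔪), ?_⟩
  ext a
  rw [RingHom.mem_ker, AlgHom.comp_apply, Ideal.Quotient.mkₐ_eq_mk]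
  change e.symm (Ideal.Quotient.mk 𝔪 a) = 0 ↔ a ∈ 𝔪
  rw [map_eq_zero_iff _ e.symm.injective, Ideal.Quotient.eq_zero_iff_mem]

/-- **The pencil parameter is transcendental.** If `g ≠ 0` is a non-unit of a domain `A` over an
algebraically closed field `K` and `h` lies in no minimal prime of `(g)`, then `g/h ∈ Frac A` is
transcendental over `K` (an algebraic, hence constant, value `c` would give `g = c h`, so either
`g = 0` or `h` in every prime containing `g`). [folklore] -/
theorem transcendental_div_of_notMem_minimalPrimes {K : Type*} [Field K] [IsAlgClosed K]
    {A : Type*} [CommRing A] [IsDomain A] [Algebra K A] {E : Type*} [Field E] [Algebra A E]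
    [Algebra K E] [IsScalarTower K A E] [IsFractionRing A E] {g h : A} (hg : g ≠ 0)
    (hgu : ¬ IsUnit g) (hgh : ∀ 𝔭 ∈ (Ideal.span {g}).minimalPrimes, h ∉ 𝔭) :
    Transcendental K (algebraMap A E g / algebraMap A E h) := by
  intro halg
  have hinjA : Function.Injective (algebraMap A E) := IsFractionRing.injective A E
  -- a minimal prime of `(g)`
  have hne : Ideal.span {g} ≠ ⊤ := by
    rwa [Ne, Ideal.span_singleton_eq_top]
  obtain ⟨𝔭, h𝔭⟩ := Ideal.nonempty_minimalPrimes hne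
  have h𝔭p : 𝔭.IsPrime := h𝔭.1.1
  have hg𝔭 : g ∈ 𝔭 := h𝔭.1.2 (Ideal.mem_span_singleton_self g)
  have hh0 : h ≠ 0 := by
    rintro rfl
    exact hgh 𝔭 h𝔭 (zero_mem 𝔭)
  -- an algebraic element over an algebraically closed field is a constant
  have hint : IsIntegral K (algebraMap A E g / algebraMap A E h) := halg.isIntegral
  obtain ⟨c, hc⟩ : algebraMap A E g / algebraMap A E h ∈ (algebraMap K E).range :=
    hint.mem_range_algebraMap_of_minpoly_splits (IsAlgClosed.splits _)
  have hgch : g = algebraMap K A c * h := by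
    apply hinjA
    rw [map_mul, ← IsScalarTower.algebraMap_apply, hc,
      div_mul_cancel₀ _ ((map_ne_zero_iff _ hinjA).mpr hh0)]
  have hmem : algebraMap K A c * h ∈ 𝔭 := hgch ▸ hg𝔭
  rcases h𝔭p.mem_or_mem hmem with h1 | h2
  · rcases eq_or_ne c 0 with rfl | hc0
    · apply hg
      rw [hgch, map_zero, zero_mul]
    · exact h𝔭p.ne_top (Ideal.eq_top_of_isUnit_mem _ h1 ((hc0.isUnit).map _))
  · exact hgh 𝔭 h𝔭 h2

/-- A subalgebra `B` of the fraction field `E` of a domain `A` containing the image of `A` has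
fraction field `E`. [folklore] -/
theorem isFractionRing_of_subalgebra {A : Type*} [CommRing A] {E : Type*} [Field E] [Algebra A E]
    [IsFractionRing A E] {K : Type*} [CommRing K] [Algebra K E] (B : Subalgebra K E)
    (hAB : ∀ a, algebraMap A E a ∈ B) : IsFractionRing B E := by
  haveI : FaithfulSMul B E := (faithfulSMul_iff_algebraMap_injective B E).mpr Subtype.val_injective
  refine IsFractionRing.of_field B E fun z => ?_
  obtain ⟨a, b, -, rfl⟩ := IsFractionRing.div_surjective (A := A) z
  exact ⟨⟨algebraMap A E a, hAB a⟩, ⟨algebraMap A E b, hAB b⟩, rfl⟩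

end TwoPointPencil

end Literature.AlgebraicGeometry.Motives

end
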